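import Literature.Geometry.DiscreteGeometry.HexagonalSpiralContacts
import HarnessLib

/-!
# Harborth 1974, (6): `n` unit discs with exactly `[3n - √(12n - 3)]` contacts, for every `n`

Sequel to `HexagonalSpiral.lean` / `HexagonalSpiralContacts.lean`. Main theorem
`exists_contactPairCount_eq_harborthNumber`: for every `N` there is a configuration
`x : Fin N → ℝ²` of non-overlapping unit-diameter discs (`Pairwise (1 ≤ dist)`) with
`contactPairCount x = harborthNumber N = ⌊3N - √(12N - 3)⌋` — the attainment half (6) of

* H. Harborth, *Lösung zu Problem 664A*, Elem. Math. **29** (1974) 14–15: "Durch Einsetzen dieser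
  Werte kann `B(n) ≥ z ≥ [3n - √(12n - 3)]` (6) nachgeprüft werden" (with `z` the spiral's contact
  count `9s² + 3s + (3s+2)i + 3j - 1`), = Heitmann–Radin 1980, §3 (2) "`C_b = H(n)` … and
  `H(n) = [3n - (12n - 3)^{1/2}]`",

i.e. the `∃`-conjunct of the named fact `Harborth1974_contactNumber` (`UnitDiscContactNumber.lean`).
`harborth1974_contactNumber_of_upperBound` records that the fact now reduces to the upper bound (5).

Contents: `harborthNumber_eq_of_sq` (evaluating the floor), `harborthNumber_of_ring` (Harborth's
"Durch Einsetzen": `9(r-1)² + 3(r-1) + ringContacts r a = [3n - √(12n-3)]` for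
`n = 3r² - 3r + 1 + a`, `0 ≤ a < 6r`, via `(6s+3+k)² < 12n - 3 ≤ (6s+4+k)²`),
`exists_ring_decomposition`, the transfer from lattice labels to discs (`dist_triPoint_eq_one_iff`:
lattice points touch iff adjacent; injective labels are `1`-separated by
`Theil2006.one_le_norm_triPoint`) and a double-counting lemma on `Fin N`. No new definitions.
-/

noncomputable section

namespace Literature.Geometry.DiscreteGeometry

open Finset
open Literature.MathematicalPhysics.StatisticalMechanics

namespace HarborthSpiral

/-! ## Harborth's number `[3n - √(12n - 3)]` at `n = 3r² - 3r + 1 + a` -/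

/-- Evaluating Harborth's number: `⌊3n - √(12n-3)⌋ = K` when `(3n-K-1)² < 12n-3 ≤ (3n-K)²`
(and `K + 1 ≤ 3n`). [folklore] -/
private theorem harborthNumber_eq_of_sq {n : ℕ} {K : ℤ} (hk : (K : ℝ) + 1 ≤ 3 * n)
    (h1 : (12 * n - 3 : ℝ) ≤ (3 * n - K) ^ 2) (h2 : (3 * n - K - 1 : ℝ) ^ 2 < 12 * n - 3) :
    harborthNumber n = K := by
  rw [harborthNumber, Int.floor_eq_iff]
  have hs1 : Real.sqrt (12 * n - 3) ≤ 3 * n - K := by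
    rw [show (3 * n - K : ℝ) = Real.sqrt ((3 * n - K) ^ 2) from (Real.sqrt_sq (by linarith)).symm]
    exact Real.sqrt_le_sqrt h1
  have hs2 : (3 * n - K - 1 : ℝ) < Real.sqrt (12 * n - 3) := (Real.lt_sqrt (by linarith)).2 h2
  constructor <;> linarith

/-- In chart `k` (`k r ≤ a < (k+1) r`, `a ≥ 1`) the ring has gained `3a - 1 - k` contacts. [folklore] -/
private theorem ringContacts_of_chart {r a : ℕ} (k : ℕ) (hk : k ≤ 5) (ha : 1 ≤ a) (h1 : k * r ≤ a)
    (h2 : a + 1 ≤ (k + 1) * r) : ringContacts r a = 3 * a - 1 - k := by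
  interval_cases k <;> (simp only [ringContacts, ι]; split_ifs <;> push_cast <;> omega)

/-- **Harborth's identity `z = [3n - √(12n - 3)]`** (Elem. Math. 29, p. 15, "(6)"): for
`n = 3s² + 3s + 1 + (s+1)k + j` the spiral configuration's contact count
`9s² + 3s + (3s+2)k + 3j - 1` (resp. `9s² + 3s`) equals `[3n - √(12n - 3)]`; here `s = r - 1`,
`(s+1)k + j = a`. [cite: Harborth1974, (6)] -/
theorem harborthNumber_of_ring {N r a : ℕ} (hr : 1 ≤ r) (ha : a < 6 * r)
    (hN : (N : ℤ) = 3 * r ^ 2 - 3 * r + 1 + a) :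
    harborthNumber N = 9 * ((r : ℤ) - 1) ^ 2 + 3 * ((r : ℤ) - 1) + ringContacts r a := by
  have hNR : (N : ℝ) = 3 * r ^ 2 - 3 * r + 1 + a := by exact_mod_cast hN
  have hrR : (1 : ℝ) ≤ r := by exact_mod_cast hr
  rcases Nat.eq_zero_or_pos a with rfl | ha1
  · rw [ringContacts_zero hr, add_zero]
    apply harborthNumber_eq_of_sq
    · rw [hNR]; push_cast; nlinarith
    · rw [hNR]; push_cast; nlinarith
    · rw [hNR]; push_cast; nlinarith
  · -- `a ≥ 1`: chart `k` with `k r ≤ a < (k+1) r`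
    obtain ⟨k, hk5, hk1, hk2⟩ : ∃ k : ℕ, k ≤ 5 ∧ k * r ≤ a ∧ a + 1 ≤ (k + 1) * r := by
      by_cases g0 : a + 1 ≤ r
      · exact ⟨0, by omega, by omega, by omega⟩
      by_cases g1 : a + 1 ≤ 2 * r
      · exact ⟨1, by omega, by omega, by omega⟩
      by_cases g2 : a + 1 ≤ 3 * r
      · exact ⟨2, by omega, by omega, by omega⟩
      by_cases g3 : a + 1 ≤ 4 * r
      · exact ⟨3, by omega, by omega, by omega⟩
      by_cases g4 : a + 1 ≤ 5 * r
      · exact ⟨4, by omega, by omega, by omega⟩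
      · exact ⟨5, by omega, by omega, by omega⟩
    rw [ringContacts_of_chart k hk5 ha1 hk1 hk2]
    have hk1R : (k : ℝ) * r ≤ a := by exact_mod_cast hk1
    have hk2R : (a : ℝ) + 1 ≤ (k + 1) * r := by exact_mod_cast hk2
    have ha1R : (1 : ℝ) ≤ a := by exact_mod_cast ha1
    have hk5R : (k : ℝ) ≤ 5 := by exact_mod_cast hk5
    apply harborthNumber_eq_of_sq
    · rw [hNR]; push_cast; nlinarith
    · rw [hNR]; push_cast; nlinarith [sq_nonneg ((k : ℝ) - 2)]
    · rw [hNR]; push_cast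
      interval_cases k <;> (push_cast at hk1R hk2R ⊢; nlinarith)

/-- Every `N ≥ 1` is `3r² - 3r + 1 + a` with `r ≥ 1`, `0 ≤ a < 6r` (ring decomposition of the
spiral). [folklore] -/
private theorem exists_ring_decomposition {N : ℕ} (hN : 1 ≤ N) :
    ∃ r a : ℕ, 1 ≤ r ∧ a < 6 * r ∧ (N : ℤ) = 3 * r ^ 2 - 3 * r + 1 + a := by
  induction N, hN using Nat.le_induction with
  | base => exact ⟨1, 0, le_rfl, by omega, by norm_num⟩
  | succ N hN ih =>
    obtain ⟨r, a, hr, ha, h⟩ := ih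
    by_cases h' : a + 1 < 6 * r
    · exact ⟨r, a + 1, hr, h', by push_cast; rw [h]; ring⟩
    · refine ⟨r + 1, 0, by omega, by omega, ?_⟩
      have h6 : (a : ℤ) + 1 = 6 * r := by exact_mod_cast (show a + 1 = 6 * r by omega)
      push_cast
      linear_combination h + h6

/-! ## From lattice labels to discs in the plane -/

/-- Lattice points at norm-form distance `1` are exactly the touching pairs of discs. [cite: Theil2006, §2.3 Remark 2.5] -/
theorem dist_triPoint_eq_one_iff (u v : ℤ × ℤ) :
    dist (Theil2006.triPoint u) (Theil2006.triPoint v) = 1 ↔ Adj u v := by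
  rw [adj_comm, Adj, Theil2006.dist_triPoint]
  have hsq := Theil2006.norm_triPoint_sq (u - v)
  constructor
  · intro h
    rw [h, one_pow] at hsq
    unfold normForm
    exact_mod_cast hsq.symm
  · intro h
    unfold normForm at h
    rw [h, Int.cast_one] at hsq
    exact (pow_eq_one_iff_of_nonneg (norm_nonneg _) two_ne_zero).1 hsq

/-- Double counting on `Fin N`: for a symmetric irreflexive relation the number of ordered related
pairs is twice the number of related pairs `i < j`. [folklore] -/
private theorem sum_card_filter_eq_two_mul {N : ℕ} (R : Fin N → Fin N → Prop) [DecidableRel R]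
    (hsymm : ∀ i j, R i j → R j i) (hirr : ∀ i, ¬ R i i) :
    ∑ i, (univ.filter (R i)).card =
      2 * (univ.filter fun p : Fin N × Fin N => p.1 < p.2 ∧ R p.1 p.2).card := by
  have hL : ∀ i : Fin N, (univ.filter (R i)).card =
      (∑ j ∈ Ioi i, if R i j then 1 else 0) + ∑ j ∈ Iio i, if R i j then 1 else 0 := by
    intro i
    rw [card_filter, Fintype.sum_eq_add_sum_compl i, if_neg (hirr i), zero_add,
      ← Ioi_disjUnion_Iio, sum_disjUnion]
  have hswap : ∑ i : Fin N, ∑ j ∈ Iio i, (if R i j then 1 else 0) =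
      ∑ i : Fin N, ∑ j ∈ Ioi i, (if R i j then 1 else 0) := by
    rw [sum_comm' (t' := univ) (s' := fun j => Ioi j)]
    · refine sum_congr rfl fun j _ => sum_congr rfl fun i _ => ?_
      by_cases h : R i j
      · rw [if_pos h, if_pos (hsymm i j h)]
      · rw [if_neg h, if_neg (fun h' => h (hsymm j i h'))]
    · intro i j
      simp [mem_Ioi, mem_Iio]
  have hR : (univ.filter fun p : Fin N × Fin N => p.1 < p.2 ∧ R p.1 p.2).card =
      ∑ i : Fin N, ∑ j ∈ Ioi i, if R i j then 1 else 0 := by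
    rw [card_filter, ← univ_product_univ, sum_product]
    refine sum_congr rfl fun i _ => ?_
    have hIoi : Ioi i = univ.filter (fun j => i < j) := by ext j; simp
    rw [hIoi, sum_filter]
    refine sum_congr rfl fun j _ => ?_
    by_cases h : i < j <;> simp [h]
  simp_rw [hL, sum_add_distrib, hswap, hR]
  ring

end HarborthSpiral

open HarborthSpiral

/-- Injectively labelled lattice points are centres of non-overlapping unit discs (non-zero
vectors of `A₂` have length `≥ 1`). [cite: Theil2006, §2.3 Remark 2.5] -/
theorem pairwise_one_le_dist_triPoint {N : ℕ} {c : Fin N → ℤ × ℤ} (hc : Function.Injective c) :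
    Pairwise fun i j => 1 ≤ dist (Theil2006.triPoint (c i)) (Theil2006.triPoint (c j)) := by
  intro i j hij
  rw [Theil2006.dist_triPoint]
  exact Theil2006.one_le_norm_triPoint (sub_ne_zero.2 (hc.ne hij))

/-- For an injective lattice labelling `c : Fin N → ℤ²`, twice the number of touching pairs of the
discs `triPoint ∘ c` is the ordered adjacency count `adjCount` of the label set (Heitmann–Radin's
`C_b` counted from both ends of each bond). [cite: HeitmannRadin1980, §2 (p. 283)] -/
theorem two_mul_contactPairCount_triPoint {N : ℕ} (c : Fin N → ℤ × ℤ)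
    (hc : Function.Injective c) :
    2 * contactPairCount (fun i => Theil2006.triPoint (c i)) = adjCount (univ.image c) := by
  have htr : ∀ g : ℤ × ℤ → ℕ, ∑ i : Fin N, g (c i) = ∑ q ∈ univ.image c, g q := fun g =>
    (sum_image fun i _ j _ h => hc h).symm
  have h1 : contactPairCount (fun i => Theil2006.triPoint (c i)) =
      (univ.filter fun p : Fin N × Fin N => p.1 < p.2 ∧ Adj (c p.1) (c p.2)).card := by
    unfold contactPairCount
    congr 1
    ext p
    simp only [mem_filter, mem_univ, true_and, dist_triPoint_eq_one_iff]
  have h2 : ∑ i : Fin N, (univ.filter fun j => Adj (c i) (c j)).card = adjCount (univ.image c) := by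
    rw [adjCount, ← htr]
    refine Fintype.sum_congr _ _ fun i => ?_
    rw [card_filter, card_filter]
    exact htr (fun q => if Adj (c i) q then 1 else 0)
  rw [h1, ← h2]
  exact (sum_card_filter_eq_two_mul (fun i j => Adj (c i) (c j))
    (fun i j h => (adj_comm _ _).1 h) (fun i => not_adj_self _)).symm

/-- `[3·0 - √(12·0 - 3)] = 0` (`√` of a negative number is `0`). [cite: Harborth1974, p. 14] -/
theorem harborthNumber_zero : harborthNumber 0 = 0 := by
  rw [harborthNumber, Nat.cast_zero, mul_zero, mul_zero, zero_sub,
    Real.sqrt_eq_zero'.2 (by norm_num), neg_zero, Int.floor_zero]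

/-- **Harborth 1974, (6), lattice form.** For every `N` there is an injective labelling
`c : Fin N → ℤ²` (the first `N` labels of the hexagonal spiral: `H_{r-1}` plus `a` labels of ring
`r`, `N = 3r² - 3r + 1 + a`) whose discs `triPoint ∘ c` have exactly `[3N - √(12N - 3)]` touching
pairs. [cite: Harborth1974, (6)] -/
theorem exists_injective_contactPairCount_eq_harborthNumber (N : ℕ) :
    ∃ c : Fin N → ℤ × ℤ, Function.Injective c ∧
      (contactPairCount (fun i => Theil2006.triPoint (c i)) : ℤ) = harborthNumber N := by
  rcases Nat.eq_zero_or_pos N with rfl | hN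
  · refine ⟨fun i => i.elim0, fun i => i.elim0, ?_⟩
    rw [harborthNumber_zero]
    simp [contactPairCount]
  obtain ⟨r, a, hr, ha, hNra⟩ := exists_ring_decomposition hN
  obtain ⟨hcard', hcount⟩ := card_config hr ha.le
  have hcard : (config r a).card = N := by
    have : ((config r a).card : ℤ) = N := by rw [hcard', hNra]
    exact_mod_cast this
  set S := config r a with hS
  let e : S ≃ Fin N := S.equivFinOfCardEq hcard
  let c : Fin N → ℤ × ℤ := fun i => (e.symm i : ℤ × ℤ)
  have hc : Function.Injective c := fun i j h =>
    e.symm.injective (Subtype.val_injective h)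
  have himage : univ.image c = S := by
    ext q
    simp only [mem_image, mem_univ, true_and, c]
    constructor
    · rintro ⟨i, rfl⟩
      exact (e.symm i).2
    · intro hq
      exact ⟨e ⟨q, hq⟩, by simp⟩
  refine ⟨c, hc, ?_⟩
  have h3 := two_mul_contactPairCount_triPoint c hc
  rw [himage] at h3
  have h4 := harborthNumber_of_ring hr ha hNra
  have h5 : (adjCount S : ℤ) = 2 * contactPairCount (fun i => Theil2006.triPoint (c i)) := by
    exact_mod_cast h3.symm
  linarith

/-- **Harborth 1974, (6): the construction.** For every `N` there are `N` non-overlapping unit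
discs in the plane (pairwise centre distance `≥ 1`) with exactly `[3N - √(12N - 3)]` touching
pairs: the first `N` discs of the hexagonal spiral in the triangular lattice `A₂`. This is the
lower-bound half (6) of Harborth's theorem / Heitmann–Radin 1980 §3 (2) (`C_b = H(n)`), i.e. the
`∃`-conjunct of the named fact `Harborth1974_contactNumber`; the upper bound (5) for FREE discs
remains a named fact (its printed proofs use Euler's formula for the plane contact graph).
[cite: Harborth1974, (6)] -/
theorem exists_contactPairCount_eq_harborthNumber (N : ℕ) :
    ∃ x : Fin N → EuclideanSpace ℝ (Fin 2),
      (Pairwise fun i j => 1 ≤ dist (x i) (x j)) ∧ (contactPairCount x : ℤ) = harborthNumber N := by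
  obtain ⟨c, hc, h⟩ := exists_injective_contactPairCount_eq_harborthNumber N
  exact ⟨_, pairwise_one_le_dist_triPoint hc, h⟩

/-- The named fact `Harborth1974_contactNumber` reduces to Harborth's upper bound (5): the
attainment half (6) is the theorem above. [cite: Harborth1974, (5)–(6)] -/
theorem harborth1974_contactNumber_of_upperBound
    (h : ∀ (N : ℕ) (x : Fin N → EuclideanSpace ℝ (Fin 2)),
      (Pairwise fun i j => 1 ≤ dist (x i) (x j)) → (contactPairCount x : ℤ) ≤ harborthNumber N) :
    Harborth1974_contactNumber :=
  fun N => ⟨h N, exists_contactPairCount_eq_harborthNumber N⟩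

/-- Ground states (maximal configurations) of `N` sticky discs have at least `[3N - √(12N - 3)]`
bonds: Heitmann–Radin's `C_b = B(N) ≥ H(N)` for a maximal `C`. [cite: HeitmannRadin1980, Theorem (1)] -/
theorem IsMaximalDiscConfig.harborthNumber_le_contactPairCount {N : ℕ}
    {x : Fin N → EuclideanSpace ℝ (Fin 2)} (hx : IsMaximalDiscConfig x) :
    harborthNumber N ≤ contactPairCount x := by
  obtain ⟨y, hy, hyN⟩ := exists_contactPairCount_eq_harborthNumber N
  rw [← hyN]
  exact_mod_cast hx.2 y hy

end Literature.Geometry.DiscreteGeometry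

end
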